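import Summits.KontsevichZagierPeriods.KontsevichZagierPeriods.Theorems.OctahedralSymmetryZhaoRelationInKZDefs
import Summits.KontsevichZagierPeriods.KontsevichZagierPeriods.Theorems.MzvKernelInKZ.Negative.ScalingDivision
import Literature.NumberTheory.Transcendental.KZGroundingRelations
import Literature.NumberTheory.Transcendental.KZSubcalculusInvariants

/-!
# `ZhaoRelationInKZ` (stmt-KontsevichZagierPeriods-9433), line `Sketch`: common lemmas

Companion proof file of `OctahedralSymmetryZhaoRelationInKZDefs.lean` (theorems only):

* the elementary API of the canonical representations `repRe/repIm/rep`, of the classes `Z b W`,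
  `ZP b b' U V` (`ZP = Z * Z` by `KZ.of_mul_of`), and of `evalRow` (additivity, scaling);
* **soundness of the certificate checker**: `certCheck X rows N T = true` and
  `evalRow ρ ∈ KZ.relations` for every row give `N • evalRow T ∈ KZ.relations`
  (`certCheck_sound`) — pure bookkeeping in the free abelian group `KZ.FormalRep`;
* the low-dimensional descriptions of the domains (`KZ.openOrderedSimplex 1, 2, 3`, the product
  domain `(0,1) × Δ₂`) in the literal shapes used by the route's statements;
* iterated integrand additivity with INTEGER coefficients (`of_sub_sum_zsmul_mem_relations`),
  the form in which every engine of the line delivers its rows.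

References: M. Kontsevich, D. Zagier, *Periods* (2001), §1.2 (rule (1)).
-/

noncomputable section

open Set MeasureTheory
open Literature.NumberTheory.Transcendental Literature.NumberTheory.Transcendental.KZ

namespace Summit.KontsevichZagierPeriods.OctahedralSymmetry.ZhaoRelationInKZ

/-! ## The canonical representations -/

/-- The domain of `repRe W`. [folklore] -/
@[simp] theorem repRe_domain (W : List (Fin 5)) (h : LevelFour.IsConvergent W) :
    (repRe W h).domain = openOrderedSimplex W.length := rfl

/-- The domain of `repIm W`. [folklore] -/
@[simp] theorem repIm_domain (W : List (Fin 5)) (h : LevelFour.IsConvergent W) :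
    (repIm W h).domain = openOrderedSimplex W.length := rfl

/-- The integrand of `repRe W` is the real part of the complex word integrand. [folklore] -/
@[simp] theorem repRe_integrand (W : List (Fin 5)) (h : LevelFour.IsConvergent W) :
    (repRe W h).integrand = levelFourIntegrandRe W := rfl

/-- The integrand of `repIm W` is the imaginary part of the complex word integrand. [folklore] -/
@[simp] theorem repIm_integrand (W : List (Fin 5)) (h : LevelFour.IsConvergent W) :
    (repIm W h).integrand = levelFourIntegrandIm W := rfl

/-- `rep false = repRe`. [folklore] -/
@[simp] theorem rep_false (W : List (Fin 5)) (h : LevelFour.IsConvergent W) :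
    rep false W h = repRe W h := rfl

/-- `rep true = repIm`. [folklore] -/
@[simp] theorem rep_true (W : List (Fin 5)) (h : LevelFour.IsConvergent W) :
    rep true W h = repIm W h := rfl

/-- The domain of `rep b W` is the open ordered simplex. [folklore] -/
@[simp] theorem rep_domain (b : Bool) (W : List (Fin 5)) (h : LevelFour.IsConvergent W) :
    (rep b W h).domain = openOrderedSimplex W.length := by
  cases b <;> rfl

/-- The integrand of `rep false W` at a point. [folklore] -/
theorem rep_false_integrand_apply (W : List (Fin 5)) (h : LevelFour.IsConvergent W)
    (t : Fin W.length → ℝ) : (rep false W h).integrand t = (levelFourIntegrandC W t).re := rfl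

/-- The integrand of `rep true W` at a point. [folklore] -/
theorem rep_true_integrand_apply (W : List (Fin 5)) (h : LevelFour.IsConvergent W)
    (t : Fin W.length → ℝ) : (rep true W h).integrand t = (levelFourIntegrandC W t).im := rfl

/-- `Z b W` is the class of `rep b W` for a convergent word. [folklore] -/
theorem Z_eq_of (b : Bool) (W : List (Fin 5)) (h : LevelFour.IsConvergent W) :
    Z b W = of (rep b W h) := by
  simp [Z, h]

/-- `Z b W = 0` for a non-convergent word. [folklore] -/
theorem Z_eq_zero (b : Bool) (W : List (Fin 5)) (h : ¬ LevelFour.IsConvergent W) :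
    Z b W = 0 := by
  simp [Z, h]

/-- `ZP b b' U V` is the class of the product representation for convergent words. [folklore] -/
theorem ZP_eq_of (b b' : Bool) (U V : List (Fin 5)) (hU : LevelFour.IsConvergent U)
    (hV : LevelFour.IsConvergent V) : ZP b b' U V = of ((rep b U hU).prod (rep b' V hV)) := by
  simp [ZP, hU, hV]

/-- **`ZP = Z * Z`** (the product in `KZ.FormalRep` of two classes is the class of the Fubini
product, `KZ.of_mul_of`; both sides vanish when a word is not convergent).
[cite: KontsevichZagier2001, §4.1] -/
theorem ZP_eq_mul (b b' : Bool) (U V : List (Fin 5)) : ZP b b' U V = Z b U * Z b' V := by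
  by_cases hU : LevelFour.IsConvergent U
  · by_cases hV : LevelFour.IsConvergent V
    · rw [ZP_eq_of b b' U V hU hV, Z_eq_of b U hU, Z_eq_of b' V hV, of_mul_of]
    · simp [ZP, Z, hU, hV]
  · simp [ZP, Z, hU]

/-! ## `evalRow`: additivity, scaling, and soundness of the checker -/

/-- `evalRow [] = 0`. [folklore] -/
@[simp] theorem evalRow_nil : evalRow [] = 0 := rfl

/-- `evalRow` of a cons. [folklore] -/
@[simp] theorem evalRow_cons (p : Sym × ℤ) (ρ : Row) :
    evalRow (p :: ρ) = p.2 • Z p.1.1 p.1.2 + evalRow ρ := by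
  simp [evalRow]

/-- `evalRow` is additive under concatenation. [folklore] -/
theorem evalRow_append (ρ₁ ρ₂ : Row) : evalRow (ρ₁ ++ ρ₂) = evalRow ρ₁ + evalRow ρ₂ := by
  induction ρ₁ with
  | nil => simp
  | cons p ρ ih => simp [ih, add_assoc]

/-- `evalRow (scaleRow N ρ) = N • evalRow ρ`. [folklore] -/
theorem evalRow_scaleRow (N : ℤ) (ρ : Row) : evalRow (scaleRow N ρ) = N • evalRow ρ := by
  induction ρ with
  | nil => simp [scaleRow]
  | cons p ρ ih =>
    simp only [scaleRow, List.map_cons] at ih ⊢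
    rw [evalRow_cons, evalRow_cons, ih, smul_add, mul_smul]

/-- The real-part row of a term list evaluates to `Σ c • Z false W`. [folklore] -/
theorem evalRow_re (L : List (ℤ × List (Fin 5))) :
    evalRow (Row.re L) = (L.map fun p => p.1 • Z false p.2).sum := by
  induction L with
  | nil => rfl
  | cons p L ih =>
    simp only [Row.re, List.map_cons, List.sum_cons] at ih ⊢
    rw [evalRow_cons, ih]

/-- The imaginary-part row of a term list evaluates to `Σ c • Z true W`. [folklore] -/
theorem evalRow_im (L : List (ℤ × List (Fin 5))) :
    evalRow (Row.im L) = (L.map fun p => p.1 • Z true p.2).sum := by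
  induction L with
  | nil => rfl
  | cons p L ih =>
    simp only [Row.im, List.map_cons, List.sum_cons] at ih ⊢
    rw [evalRow_cons, ih]

/-- Adding into a bucket list adds the corresponding multiple of the class. [folklore] -/
theorem evalRow_addTo (acc : Row) (s : Sym) (c : ℤ) :
    evalRow (addTo acc s c) = evalRow acc + c • Z s.1 s.2 := by
  induction acc with
  | nil => simp [addTo]
  | cons p acc ih =>
    obtain ⟨s', c'⟩ := p
    by_cases h : s' = s
    · subst h
      simp only [addTo, if_true, evalRow_cons, add_smul]
      abel
    · simp only [addTo, if_neg h, evalRow_cons, ih]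
      abel

/-- Collecting a row into buckets does not change its evaluation. [folklore] -/
theorem evalRow_collect (ρ : Row) : evalRow (collect ρ) = evalRow ρ := by
  induction ρ with
  | nil => rfl
  | cons p ρ ih =>
    obtain ⟨s, c⟩ := p
    simp only [collect, evalRow_addTo, ih, evalRow_cons]
    abel

/-- A bucket list all of whose coefficients vanish evaluates to `0`. [folklore] -/
theorem evalRow_eq_zero_of_all (ρ : Row) (h : (ρ.all fun p => p.2 == 0) = true) :
    evalRow ρ = 0 := by
  induction ρ with
  | nil => rfl
  | cons p ρ ih =>
    simp only [List.all_cons, Bool.and_eq_true, beq_iff_eq] at h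
    rw [evalRow_cons, h.1, zero_smul, zero_add, ih h.2]

/-- **A certified-zero row evaluates to zero.** [folklore] -/
theorem evalRow_eq_zero_of_isZeroRow (ρ : Row) (h : isZeroRow ρ = true) : evalRow ρ = 0 := by
  rw [← evalRow_collect]
  exact evalRow_eq_zero_of_all _ h

/-- A linear combination of rows that are relations is a relation. [folklore] -/
theorem evalRow_lincomb_mem (X : List ℤ) (rows : List Row)
    (h : ∀ ρ ∈ rows, evalRow ρ ∈ relations) : evalRow (lincomb X rows) ∈ relations := by
  induction rows generalizing X with
  | nil => cases X <;> simp [lincomb, relations.zero_mem]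
  | cons ρ rows ih =>
    cases X with
    | nil => simp [lincomb, relations.zero_mem]
    | cons x X =>
      simp only [lincomb, evalRow_append, evalRow_scaleRow]
      exact relations.add_mem (relations.zsmul_mem (h ρ (by simp)) x)
        (ih X fun ρ' hρ' => h ρ' (by simp [hρ']))

/-- **Soundness of the certificate checker.** If `Σⱼ Xⱼ ρⱼ − N·T` collects to the zero row and
every `ρⱼ` evaluates into `KZ.relations`, then `N • evalRow T ∈ KZ.relations`. [folklore] -/
theorem certCheck_sound (X : List ℤ) (rows : List Row) (N : ℤ) (T : Row)
    (hc : certCheck X rows N T = true) (h : ∀ ρ ∈ rows, evalRow ρ ∈ relations) :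
    N • evalRow T ∈ relations := by
  have h0 := evalRow_eq_zero_of_isZeroRow _ hc
  rw [evalRow_append, evalRow_scaleRow, neg_smul, ← sub_eq_add_neg, sub_eq_zero] at h0
  rw [← h0]
  exact evalRow_lincomb_mem X rows h

/-- **Integer division** (route item `IntegerDivision`, proved in the tree): a positive integer
multiple of `c` is a relation only if `c` is. [cite: KontsevichZagier2001, §1.2] -/
theorem mem_relations_of_zsmul_mem {c : FormalRep} {N : ℤ} (hN : 0 < N)
    (h : N • c ∈ relations) : c ∈ relations := by
  obtain ⟨n, rfl⟩ := Int.eq_ofNat_of_zero_le hN.le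
  have hn : 0 < n := by exact_mod_cast hN
  exact Summit.KontsevichZagierPeriods.MzvKernelInKZ.Negative.mem_relations_of_nsmul_mem hn
    (by simpa using h)

/-! ## Iterated integrand additivity with integer coefficients -/

/-- The class of an integer multiple of an integrand is the integer multiple of the class:
`[σ, k f] − k • [σ, f] ∈ relations` (`k : ℤ`; rule (1b) iterated, via
`KZ.IntegralRep.of_constMul_nat_sub_nsmul_mem_relations` and one sign flip).
[cite: KontsevichZagier2001, §1.2 rule (1)] -/
theorem of_constMul_int_sub_zsmul_mem_relations {n : ℕ} (r : IntegralRep n) (k : ℤ) :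
    of (r.constMul (k : ℝ) (isAlgebraic_int k)) - k • of r ∈ relations := by
  rcases Int.eq_nat_or_neg k with ⟨m, rfl | rfl⟩
  · have h := IntegralRep.of_constMul_nat_sub_nsmul_mem_relations r m
    have e : r.constMul ((m : ℤ) : ℝ) (isAlgebraic_int (m : ℤ)) = r.constMul (m : ℝ) (isAlgebraic_nat m) :=
      IntegralRep.ext' rfl (funext fun x => by simp)
    rw [e]
    simpa using h
  · have h := IntegralRep.of_constMul_nat_sub_nsmul_mem_relations r m
    -- `[σ, −m f] + [σ, m f] ∈ relations` by opposite integrands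
    have hneg : of (r.constMul (m : ℝ) (isAlgebraic_nat m)) +
        of (r.constMul ((-(m : ℤ) : ℤ) : ℝ) (isAlgebraic_int (-(m : ℤ)))) ∈ relations :=
      of_add_of_mem_relations_of_eqOn_neg rfl fun x _ => by simp
    have : of (r.constMul ((-(m : ℤ) : ℤ) : ℝ) (isAlgebraic_int (-(m : ℤ)))) - (-(m : ℤ)) • of r =
        (of (r.constMul (m : ℝ) (isAlgebraic_nat m)) +
          of (r.constMul ((-(m : ℤ) : ℤ) : ℝ) (isAlgebraic_int (-(m : ℤ))))) -
        (of (r.constMul (m : ℝ) (isAlgebraic_nat m)) - m • of r) := by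
      simp only [neg_smul, natCast_zsmul]
      abel
    rw [this]
    exact relations.sub_mem hneg h

/-- **Splitting an integrand into an integer combination** (rule (1b) iterated): if `r` and the
`R p` (`p ∈ L`, a list of (coefficient, representation) pairs) have a common domain on which
`r.integrand = Σ_{(k, R) ∈ L} k · R.integrand`, then `[r] − Σ k • [R] ∈ relations`.
[cite: KontsevichZagier2001, §1.2 rule (1)] -/
theorem of_sub_sum_zsmul_mem_relations {n : ℕ} {ι : Type*} (L : List ι) (k : ι → ℤ)
    (R : ι → IntegralRep n) (r : IntegralRep n) (hdom : ∀ i ∈ L, (R i).domain = r.domain)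
    (h : EqOn r.integrand (fun x => (L.map fun i => (k i : ℝ) * (R i).integrand x).sum) r.domain) :
    of r - (L.map fun i => k i • of (R i)).sum ∈ relations := by
  classical
  -- the scaled representations, indexed by positions
  set S : Fin L.length → IntegralRep n := fun j =>
    (R (L.get j)).constMul (k (L.get j) : ℝ) (isAlgebraic_int _) with hS
  have key : of r - ∑ j : Fin L.length, of (S j) ∈ relations := by
    refine of_sub_sum_integrand_mem_relations Finset.univ S r (fun j _ => ?_) (fun x hx => ?_)
    · simpa [hS] using hdom _ (List.get_mem L j)
    · rw [h hx]
      simp only [hS, IntegralRep.integrand_constMul]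
      rw [← List.sum_ofFn]
      congr 1
      conv_lhs => rw [← List.ofFn_get L, List.map_ofFn]
      rfl
  have hsm : ∑ j : Fin L.length, (of (S j) - k (L.get j) • of (R (L.get j))) ∈ relations :=
    sum_mem fun j _ => of_constMul_int_sub_zsmul_mem_relations _ _
  have hlist : (L.map fun i => k i • of (R i)).sum =
      ∑ j : Fin L.length, k (L.get j) • of (R (L.get j)) := by
    rw [← List.sum_ofFn]
    congr 1
    conv_lhs => rw [← List.ofFn_get L, List.map_ofFn]
    rfl
  rw [hlist]
  have : of r - ∑ j : Fin L.length, k (L.get j) • of (R (L.get j)) =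
      (of r - ∑ j : Fin L.length, of (S j)) +
      ∑ j : Fin L.length, (of (S j) - k (L.get j) • of (R (L.get j))) := by
    rw [Finset.sum_sub_distrib]; abel
  rw [this]
  exact relations.add_mem key hsm

/-! ## The domains in the literal shapes of the route -/

/-- `Δ₁ = (0, 1)`. [folklore] -/
theorem openOrderedSimplex_one :
    openOrderedSimplex 1 = {t : Fin 1 → ℝ | 0 < t 0 ∧ t 0 < 1} := by
  ext t
  simp only [openOrderedSimplex, mem_setOf_eq, Fin.forall_fin_one]
  constructor
  · rintro ⟨h0, h1, -⟩; exact ⟨h0, h1⟩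
  · rintro ⟨h0, h1⟩; exact ⟨h0, h1, Subsingleton.strictAnti t⟩

/-- `Δ₂ = {1 > t₀ > t₁ > 0}`. [folklore] -/
theorem openOrderedSimplex_two :
    openOrderedSimplex 2 = {t : Fin 2 → ℝ | 1 > t 0 ∧ t 0 > t 1 ∧ t 1 > 0} := by
  ext t
  simp only [openOrderedSimplex, mem_setOf_eq]
  constructor
  · rintro ⟨h0, h1, ha⟩
    exact ⟨h1 0, ha (show (0 : Fin 2) < 1 by decide), h0 1⟩
  · rintro ⟨h0, h01, h1⟩
    refine ⟨fun i => ?_, fun i => ?_, fun i j hij => ?_⟩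
    · fin_cases i
      · show 0 < t 0; linarith
      · show 0 < t 1; linarith
    · fin_cases i
      · show t 0 < 1; linarith
      · show t 1 < 1; linarith
    · fin_cases i <;> fin_cases j
      · exact absurd hij (lt_irrefl _)
      · show t 1 < t 0; linarith
      · exact absurd (Fin.lt_def.mp hij) (by decide)
      · exact absurd hij (lt_irrefl _)

/-- `Δ₃ = {1 > t₀ > t₁ > t₂ > 0}` (the literal domain of the crux). [folklore] -/
theorem openOrderedSimplex_three :
    openOrderedSimplex 3 = {t : Fin 3 → ℝ | 1 > t 0 ∧ t 0 > t 1 ∧ t 1 > t 2 ∧ t 2 > 0} := by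
  ext t
  simp only [openOrderedSimplex, mem_setOf_eq]
  constructor
  · rintro ⟨h0, h1, ha⟩
    exact ⟨h1 0, ha (show (0 : Fin 3) < 1 by decide), ha (show (1 : Fin 3) < 2 by decide), h0 2⟩
  · rintro ⟨h0, h01, h12, h2⟩
    refine ⟨fun i => ?_, fun i => ?_, fun i j hij => ?_⟩
    · fin_cases i
      · show 0 < t 0; linarith
      · show 0 < t 1; linarith
      · show 0 < t 2; linarith
    · fin_cases i
      · show t 0 < 1; linarith
      · show t 1 < 1; linarith
      · show t 2 < 1; linarith
    · have hij' := Fin.lt_def.mp hij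
      fin_cases i <;> fin_cases j <;> simp at hij' ⊢ <;> linarith

/-- The product domain `(0,1) × Δ₂ ⊆ ℝ³` of a one-letter and a two-letter representation, in
the literal shape of the route (`LevelFourStuffleInKZ`'s `P.domain`). [folklore] -/
theorem prodDomain_one_two (r : IntegralRep 1) (s : IntegralRep 2)
    (hr : r.domain = openOrderedSimplex 1) (hs : s.domain = openOrderedSimplex 2) :
    IntegralRep.prodDomain r s =
      {t : Fin 3 → ℝ | (0 < t 0 ∧ t 0 < 1) ∧ 1 > t 1 ∧ t 1 > t 2 ∧ t 2 > 0} := by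
  ext t
  simp only [IntegralRep.prodDomain, hr, hs, openOrderedSimplex_one, openOrderedSimplex_two,
    mem_setOf_eq]
  rfl

end Summit.KontsevichZagierPeriods.OctahedralSymmetry.ZhaoRelationInKZ

end
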